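import Summits.CriticalPhenomena.Ising3D.Control2DPolyCertAuto
import Summits.CriticalPhenomena.Ising3D.Control2DL11GapATable
import Summits.CriticalPhenomena.Ising3D.Control2DL11GapAData8
import Summits.CriticalPhenomena.Ising3D.Control2DUZn55c00a
import Summits.CriticalPhenomena.Ising3D.Control2DUZn55c00b
import Summits.CriticalPhenomena.Ising3D.Control2DUZn55c00c
import Summits.CriticalPhenomena.Ising3D.Control2DUZn55c00d
import Summits.CriticalPhenomena.Ising3D.Control2DUZn55c02a
import Summits.CriticalPhenomena.Ising3D.Control2DUZn55c02b
import Summits.CriticalPhenomena.Ising3D.Control2DUZn55c02c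
import Summits.CriticalPhenomena.Ising3D.Control2DUZn55c02d
import HarnessLib

/-!
# Kernel replay of the RB-1 certificate `j106899_functional_deriv2d_L11_E032_eps1.0006.json` (Λ = 11, E₀ = 32): Δ_ε < 5003/5000 at Δ_σ = 1/8: cell data, spins 2
(cell `pub-ising3x`, seat controls-1 gen 16; KERNEL PATH for the 2D γ-certificates, Λ = 11 — CONTROL-ONLY)

HONEST FRAMING: lottery ticket; floor = tightest certified 3D Ising CFT bounds; no exact-solution
claim without a proof. CONTROL-ONLY (`d = 2`, `Δ_σ = 1/8`).

Split layout (controls-1 g15): each spin's cell polynomial `cellPolyZ wtgapA slL11 11 ℓ Nd` is assembled in the kernel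
from the table-independent one-sided literals `uZ Nd c k` (library files `Control2DUZn*`, `Control2DGammaL7U0n*e1005`)
into a literal `phat…` (`simp only` + `decide +kernel`); every Bernstein leaf `bernAuto phat q a L = true` (coefficients
computed in the kernel, `Control2DPolyCertAuto`) is its own kernel decision. This file is data + kernel decisions only; the cell theorems proper are assembled in `Control2DL11GapACells`.
All integers come from the seat's exact mirror (HOME/code/controls/kp3: kmirror.py / gen_cert.py, cross-checked against
the independent rational twin twin.py) and are only CHECKED here. No facts, standard axioms only.
-/

namespace Summit.CriticalPhenomena.Ising3D.Control2D

open Literature.MathematicalPhysics.QuantumFieldTheory.ConformalBootstrap3D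

set_option maxHeartbeats 0 in
set_option maxRecDepth 200000 in
/-- **Kernel check of spin 2, leaf 11** (`y ∈ [15/4, 30/4]`, range C; Bernstein coefficients of the coefficients truncated by `10^346`, computed in the kernel). [folklore] -/
theorem cellChk_gapA_s2l11 : bernAuto (ptrunc phatgapAs2 346) 4 15 15 = true := by
  decide +kernel

set_option maxHeartbeats 0 in
set_option maxRecDepth 200000 in
/-- **Kernel check of spin 2, leaf 12** (`y ∈ [15/2, 30/2]`, range C; Bernstein coefficients of the coefficients truncated by `10^346`, computed in the kernel). [folklore] -/
theorem cellChk_gapA_s2l12 : bernAuto (ptrunc phatgapAs2 346) 2 15 15 = true := by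
  decide +kernel

end Summit.CriticalPhenomena.Ising3D.Control2D
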